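import Summits.QuantumFields.BalabanUV.Beta.GAN24.WilsonLetterFlatCharges
import Summits.QuantumFields.BalabanUV.Beta.GAN24.CombSlotDerivativeBorderRead
import Summits.QuantumFields.BalabanUV.Beta.GAN24.KernelLegCharges
import Summits.QuantumFields.BalabanUV.Beta.GAN24.LinKerBlockTotals
import Summits.QuantumFields.BalabanUV.Beta.GAN24.ContactFaceJump

/-!
# `BalabanUV.Beta.GAN24.SpureSlotChargeLevelZero` — binder row G-an2-4 ∕ (CONV-C), the (S) row of RULING R-gan24p1-g27-1 B (viii), the PLAIN sub-row of (W-γ):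
# **THE LEVEL-0 SLOT CHARGES OF THE PURE S TABLE `SpureRecAt … 0`, ALL FOUR BLOCKS** — the displayed slot-constancy `hζS` of road-P2's
# `WardGammaPlainRowCentred` HOLDS on the field–field block with `ζS = 0`, is EMPTY on the multiplier–multiplier block, and FAILS on the
# field–multiplier blocks, where the charge is an explicit AFFINE function of the slot's in-block position
# (G-an2-4 formalisation swarm → CRUX TEAM (2), leaf prover `b2b-balaban-gan24-formalise-leaf-02`, gen 56, PART 1)

NOT IN PRINT; OUR BOOKKEEPING ([folklore] packaging BY NAME of: leaf-02 g55 `WilsonLetterFlatCharges.tsum_tsum_spureRecAt_zero_inl_inl` (plain ⊗ plain ≡ 0 for the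
Wilson letter), leaf-02 g47 `BorderGaugeLegContact.tsum_dz_mul_vhSAt` (the fluctuation-slot `dψ`-law of an1's border table), leaf-06's
`KernelLegCharges.summable_prod_of_biLoc`, road-P2's `LinKerBlockTotals.tsum_linKerAt'` ∕ `summable_linKerAt` and `CombSlotDerivativeBorderRead.tsum_coarse_of_off`,
leaf-01's two-block support `ContactFaceJump.linKerAt_eq_zero_of_not_twoBlock`, leaf-10's `SpineRecursiveW.locStencil_SpureRecAt`; 0 `def`, 0 cited fact,
0 `def … : Prop`, 0 sorry).  HONEST FRAMING (cell contract, verbatim): «discharging `BetaPertH` makes Bałaban's UV stability UNCONDITIONAL — a real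
constructive-QFT result; it is NOT the continuum limit and NOT the Clay problem.»  HONEST DEPENDENCY (verbatim): «continuum YM on T⁴ ⇐ BetaPertH ∧ nine spine
estimates (0/9 proved); BetaPertH ⇐ (D1) ∧ (D4) ∧ CAP+tail; G-an2-4 gates asym, D1 and NE2/3/4.»

SETTING.  Road-P2's plain sub-row of (W-γ) (`WardGammaPlainRowCentred.hasSum_comb_gaugeCharge_plain_ctr`) displays, per channel `(a, b) : Fib × Fib` and level `j`,
`hζS : ∀ κ u, Σ'_{(x,z)} SpureRecAt d Lc ρ cE cVH cΛ j κ u x z a b = ζS κ` — the PAIR-indexed plain charge of the pure S table is SLOT-CONSTANT.  At level `0`,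
`SpureRecAt … 0 κ u = cE • wilsonA d κ u + cVH • vhSAt ρ d Lc κ u` (`SpureRecAt_zero_level`), and this file decides `hζS` block by block (box root `ρ = toSite r`):
* §1 `summable_prod_spureRecAt` (EVERY level `j`: the pair family is summable on `Site × Site`, from `locStencil_SpureRecAt`), `tsum_prod_eq_tsum_tsum_swap`
  (pair sum = `Σ'_z Σ'_x`), **`tsum_prod_spureRecAt_zero_inl_inl`** — `(inl α, inl β)`: the charge is `0` at every slot (`hζS` with `ζS = 0`),
  **`tsum_prod_spureRecAt_zero_inr_inr`** — `(inr, inr)`: `0` (no such block), `spureRecAt_zero_inl_inr ∕ _inr_inl` (the fm blocks are `cVH •` the border table).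
* §2 THE BORDER TABLE's fm SLOT CHARGE IN CLOSED FORM: `tsum_vhSAt_inl_inr` (one fluctuation leg: `Σ'_x V κ u x z (inl α)(inr μ) = ((u+e_κ)_α − (z+ρ+L•e_μ)_α)·q¹`,
  the `dψ`-law at the coordinate `ψ = x_α`), `tsum_prod_vhSAt_inl_inr_eq_coarse` (pair sum = `Σ'_y ((u+e_κ−ρ)_α − L·(y+e_μ)_α)·q¹,ρ_{(μ,y)}(κ,u)`),
  `tsum_linKerAt_twoBlock` (only the blocks `blk u` and `blk u − e_μ` see the slot), and **`tsum_prod_vhSAt_inl_inr_eq`**: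
  `Σ'_{(x,z)} V κ u x z (inl α)(inr μ) = 𝟙[κ = μ]·(L^d)⁻¹·(u + e_κ − ρ − L•blk u)_α − L·𝟙[α = μ]·q¹,ρ_{(μ, blk u)}(κ,u)` — an explicit function of the
  slot's IN-BLOCK OFFSET `u − L•blk u`.
* §3 THE LOCATED NEGATIVE: **`tsum_prod_spureRecAt_zero_inl_inr_eq`** (the `(inl α, inr μ)` slot charge of the level-0 pure S table = `cVH ·` §2) and
  **`tsum_prod_spureRecAt_zero_inl_inr_step`**: for `κ = μ ≠ α` the charge changes by `cVH·(L^d)⁻¹·(1 − L·((blk(u+e_α))_α − (blk u)_α))` from the slot `u` to `u + e_α` —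
  `= cVH·(L^d)⁻¹ ≠ 0` inside a block — so `hζS` is UNSATISFIABLE on the fm blocks whenever `cVH ≠ 0` and `d ≥ 1` (road-P2's own engine E26g prints the spread:
  `27 = |cVH|·(L−1)·L^{−d}` at `D = 2`, `Lc = 3`, `cVH = −40.5`).
READING.  The transported END reads the ff channels only (the sandwich read-out kills the multiplier-leg blocks, `MultiplierZeroMass`), where `hζS` holds at level `0`
with value `0`; the fm plain sub-row is NOT a consequence of (T-F).  Level `j+1` (ff) is NOT decided here: by leaf-02 g52 `CubicPushFaceCharge.hasSum_prod_SpureRecAt_succ_inl_inl`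
it is the exit⊗exit pairing of the level-`j` vertex (sequel).  Asserts NO value of any read vector; NOTHING of (W-γ) ∕ (T-F) ∕ (INV) ∕ (S) ∕ (Q-R) ∕ (LT) ∕ (Q-L) ∕ (C) ∕
«T2Shape» ∕ (hW, hWall) discharged; NEVER «G-an2-4 closed» as (CONV-C); NOT D1, NOT `BetaPertH`, NOT continuum, NOT Clay.  2026-08-22; no existing file touched.
-/

noncomputable section

open Finset
open scoped BigOperators
open Literature.MathematicalPhysics.QuantumFieldTheory
open Literature.MathematicalPhysics.QuantumFieldTheory.Balaban1983to89
open Literature.MathematicalPhysics.QuantumFieldTheory.Balaban1983to89.Beta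
open ExpKernelCalculus (Site MKer BiLoc)
open OneStepResolventKernel (Fib LocStencil)
open AffineAveraging (box toSite unitVec unitVec_apply dz)
open AveragingContours (blk off)
open AveragingHessianKernels (Bond eq_smul_blk_of_off_eq_zero)
open AveragingHessianKernelsRooted (vhSAt linKerAt locStencil_vhSAt)
open AxialProjector (blk_zsmul)
open RootedKernelReflection (off_zsmul)
open StepJetData (wilsonA)
open Summit.QuantumFields.BalabanUV.Beta.SpineRooted (SpureRecAt SpureRecAt_zero_level locStencil_SpureRecAt)
open Summit.QuantumFields.BalabanUV.Beta.AveragingWardRootedStencils (linSymAt linSymAt_inl_inr)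
open Summit.QuantumFields.BalabanUV.Beta.GAN24.WilsonLetterFlatCharges (dz_coordFn tsum_tsum_spureRecAt_zero_inl_inl)
open Summit.QuantumFields.BalabanUV.Beta.GAN24.BorderGaugeLegContact (tsum_dz_mul_vhSAt)
open Summit.QuantumFields.BalabanUV.Beta.GAN24.KernelLegCharges (summable_prod_of_biLoc)
open Summit.QuantumFields.BalabanUV.Beta.GAN24.LinKerBlockTotals (tsum_linKerAt' summable_linKerAt)
open Summit.QuantumFields.BalabanUV.Beta.GAN24.CombSlotDerivativeBorderRead (tsum_coarse_of_off)
open Summit.QuantumFields.BalabanUV.Beta.GAN24.ContactFaceJump (linKerAt_eq_zero_of_not_twoBlock)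

namespace Summit.QuantumFields.BalabanUV.Beta.GAN24.SpureSlotChargeLevelZero

variable {d : ℕ}

/-! ## §1 Pair summability of the pure S table at every level; the level-0 ff and mm slot charges -/

/-- [folklore] **EVERY MEMBER OF THE PURE S TABLE IS SUMMABLE ON `Site × Site`** (in-block root, `Lc ≥ 1`, every level `j`, slot `(κ,u)`, channel `(a,b)`):
leaf-10's `locStencil_SpureRecAt` (a local stencil family) through leaf-06's `summable_prod_of_biLoc`. -/
theorem summable_prod_spureRecAt {Lc : ℕ} [NeZero Lc] (hLc : 1 ≤ Lc) {r : Fin (d + 1) → ℕ} (hr : r ∈ box (d + 1) Lc) (cE cVH cΛ : ℝ) (j : ℕ)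
    (κ : Fin (d + 1)) (u : Site (d + 1)) (a b : Fib d) :
    Summable fun xz : Site (d + 1) × Site (d + 1) => SpureRecAt d Lc (toSite r) cE cVH cΛ j κ u xz.1 xz.2 a b := by
  obtain ⟨Cs, δ, hδ, hS⟩ := locStencil_SpureRecAt (d := d) (Lc := Lc) hLc hr cE cVH cΛ j
  exact summable_prod_of_biLoc (hS κ u) hδ a b

/-- [folklore] A pair-summable kernel entry: the pair sum is the iterated sum with the SECOND leg outermost (`tsum_prod` + `tsum_comm`). -/
theorem tsum_prod_eq_tsum_tsum_swap {F : Site (d + 1) → Site (d + 1) → ℝ} (hF : Summable fun xz : Site (d + 1) × Site (d + 1) => F xz.1 xz.2) :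
    ∑' xz : Site (d + 1) × Site (d + 1), F xz.1 xz.2 = ∑' z, ∑' x, F x z := by
  have h1 : ∑' xz : Site (d + 1) × Site (d + 1), F xz.1 xz.2 = ∑' zx : Site (d + 1) × Site (d + 1), F zx.2 zx.1 :=
    ((Equiv.prodComm (Site (d + 1)) (Site (d + 1))).tsum_eq (fun xz : Site (d + 1) × Site (d + 1) => F xz.1 xz.2)).symm
  have h2 : Summable ((fun xz : Site (d + 1) × Site (d + 1) => F xz.1 xz.2) ∘ (Equiv.prodComm (Site (d + 1)) (Site (d + 1)))) :=
    (Equiv.summable_iff _).mpr hF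
  rw [h1]
  exact h2.tsum_prod

/-- NOT IN PRINT; OUR BOOKKEEPING.  **`hζS` AT LEVEL `0` ON THE FIELD–FIELD BLOCK, WITH `ζS = 0`**: for an in-block root, every `cE cVH cΛ`, every slot `(κ,u)` and every
ff channel `(inl α, inl β)`, `Σ'_{(x,z)} SpureRecAt d Lc ρ cE cVH cΛ 0 κ u x z (inl α)(inl β) = 0` — the Wilson letter has no plain ⊗ plain charge (leaf-02 g55
`WilsonLetterFlatCharges`) and the border table `vhSAt` has no ff block. -/
theorem tsum_prod_spureRecAt_zero_inl_inl {Lc : ℕ} [NeZero Lc] (hLc : 1 ≤ Lc) {r : Fin (d + 1) → ℕ} (hr : r ∈ box (d + 1) Lc) (cE cVH cΛ : ℝ)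
    (κ : Fin (d + 1)) (u : Site (d + 1)) (α β : Fin (d + 1)) :
    ∑' xz : Site (d + 1) × Site (d + 1), SpureRecAt d Lc (toSite r) cE cVH cΛ 0 κ u xz.1 xz.2 (Sum.inl α) (Sum.inl β) = 0 := by
  rw [tsum_prod_eq_tsum_tsum_swap (F := fun x z => SpureRecAt d Lc (toSite r) cE cVH cΛ 0 κ u x z (Sum.inl α) (Sum.inl β))
    (summable_prod_spureRecAt hLc hr cE cVH cΛ 0 κ u (Sum.inl α) (Sum.inl β))]
  exact tsum_tsum_spureRecAt_zero_inl_inl (toSite r) cE cVH cΛ κ u α β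

/-- NOT IN PRINT; OUR BOOKKEEPING.  The `HasSum` form of `tsum_prod_spureRecAt_zero_inl_inl` (road-P2's `hζS` at `j = 0`, ff channel, value `0`). -/
theorem hasSum_prod_spureRecAt_zero_inl_inl {Lc : ℕ} [NeZero Lc] (hLc : 1 ≤ Lc) {r : Fin (d + 1) → ℕ} (hr : r ∈ box (d + 1) Lc) (cE cVH cΛ : ℝ)
    (κ : Fin (d + 1)) (u : Site (d + 1)) (α β : Fin (d + 1)) :
    HasSum (fun xz : Site (d + 1) × Site (d + 1) => SpureRecAt d Lc (toSite r) cE cVH cΛ 0 κ u xz.1 xz.2 (Sum.inl α) (Sum.inl β)) 0 := by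
  rw [← tsum_prod_spureRecAt_zero_inl_inl hLc hr cE cVH cΛ κ u α β]
  exact (summable_prod_spureRecAt hLc hr cE cVH cΛ 0 κ u (Sum.inl α) (Sum.inl β)).hasSum

/-- [folklore] The level-0 pure S table has no multiplier–multiplier block (both letters vanish there by `rfl`). -/
theorem spureRecAt_zero_inr_inr {Lc : ℕ} [NeZero Lc] (ρ : Fin (d + 1) → ℤ) (cE cVH cΛ : ℝ) (κ : Fin (d + 1)) (u x z : Site (d + 1)) (μ ν : Fin (d + 1)) :
    SpureRecAt d Lc ρ cE cVH cΛ 0 κ u x z (Sum.inr μ) (Sum.inr ν) = 0 := by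
  have h1 : wilsonA d κ u x z (Sum.inr μ) (Sum.inr ν) = 0 := rfl
  have h2 : vhSAt ρ d Lc rfl κ u x z (Sum.inr μ) (Sum.inr ν) = 0 := rfl
  simp only [SpureRecAt_zero_level, Pi.add_apply, Pi.smul_apply, smul_eq_mul, h1, h2, mul_zero, add_zero]

/-- NOT IN PRINT; OUR BOOKKEEPING.  **`(inr, inr)`: the slot charge is `0`** (empty block). -/
theorem tsum_prod_spureRecAt_zero_inr_inr {Lc : ℕ} [NeZero Lc] (ρ : Fin (d + 1) → ℤ) (cE cVH cΛ : ℝ) (κ : Fin (d + 1)) (u : Site (d + 1)) (μ ν : Fin (d + 1)) :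
    ∑' xz : Site (d + 1) × Site (d + 1), SpureRecAt d Lc ρ cE cVH cΛ 0 κ u xz.1 xz.2 (Sum.inr μ) (Sum.inr ν) = 0 := by
  simp only [spureRecAt_zero_inr_inr, tsum_zero]

/-- [folklore] The `(inl α, inr μ)` block of the level-0 pure S table is `cVH ·` the border table (the Wilson letter is ff only). -/
theorem spureRecAt_zero_inl_inr {Lc : ℕ} [NeZero Lc] (ρ : Fin (d + 1) → ℤ) (cE cVH cΛ : ℝ) (κ : Fin (d + 1)) (u x z : Site (d + 1)) (α μ : Fin (d + 1)) :
    SpureRecAt d Lc ρ cE cVH cΛ 0 κ u x z (Sum.inl α) (Sum.inr μ) = cVH * vhSAt ρ d Lc rfl κ u x z (Sum.inl α) (Sum.inr μ) := by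
  have h1 : wilsonA d κ u x z (Sum.inl α) (Sum.inr μ) = 0 := rfl
  simp only [SpureRecAt_zero_level, Pi.add_apply, Pi.smul_apply, smul_eq_mul, h1, mul_zero, zero_add]

/-- [folklore] The `(inr μ, inl α)` block likewise. -/
theorem spureRecAt_zero_inr_inl {Lc : ℕ} [NeZero Lc] (ρ : Fin (d + 1) → ℤ) (cE cVH cΛ : ℝ) (κ : Fin (d + 1)) (u x z : Site (d + 1)) (μ α : Fin (d + 1)) :
    SpureRecAt d Lc ρ cE cVH cΛ 0 κ u x z (Sum.inr μ) (Sum.inl α) = cVH * vhSAt ρ d Lc rfl κ u x z (Sum.inr μ) (Sum.inl α) := by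
  have h1 : wilsonA d κ u x z (Sum.inr μ) (Sum.inl α) = 0 := rfl
  simp only [SpureRecAt_zero_level, Pi.add_apply, Pi.smul_apply, smul_eq_mul, h1, mul_zero, zero_add]

/-! ## §2 The border table's field–multiplier slot charge in closed form -/

/-- NOT IN PRINT; OUR BOOKKEEPING.  **ONE FLUCTUATION LEG OF THE BORDER TABLE, `(inl α, inr μ)` BLOCK**: for a box root, every slot `(κ,u)` and multiplier site `z`,
`Σ'_x vhSAt ρ d L κ u x z (inl α)(inr μ) = ((u + e_κ)_α − (z + ρ + L•e_μ)_α) · linSymAt ρ L u z (inl κ)(inr μ)` — leaf-02 g47's `dψ`-law `tsum_dz_mul_vhSAt` at the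
coordinate `ψ = x_α` (its gradient is the unit constant form of direction `α`). -/
theorem tsum_vhSAt_inl_inr {L : ℕ} (hL : 1 ≤ L) {r : Fin (d + 1) → ℕ} (hr : r ∈ box (d + 1) L) (κ : Fin (d + 1)) (u z : Site (d + 1)) (α μ : Fin (d + 1)) :
    ∑' x, vhSAt (toSite r) d L rfl κ u x z (Sum.inl α) (Sum.inr μ)
      = ((((u + unitVec κ) α : ℤ) : ℝ) - (((z + toSite r + (L : ℤ) • unitVec μ) α : ℤ) : ℝ)) * linSymAt (toSite r) L u z (Sum.inl κ) (Sum.inr μ) := by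
  have h := tsum_dz_mul_vhSAt hL hr κ u z μ (fun w : Fin (d + 1) → ℤ => ((w α : ℤ) : ℝ))
  have e : ∀ x, ∑ a, dz (fun w : Fin (d + 1) → ℤ => ((w α : ℤ) : ℝ)) a x * vhSAt (toSite r) d L rfl κ u x z (Sum.inl a) (Sum.inr μ)
      = vhSAt (toSite r) d L rfl κ u x z (Sum.inl α) (Sum.inr μ) := fun x => by
    simp only [dz_coordFn, ite_mul, one_mul, zero_mul, Finset.sum_ite_eq', Finset.mem_univ, if_true]
  rw [tsum_congr e] at h
  exact h

/-- [folklore] The border table's `(inl, inr)` entries are summable on `Site × Site` (local stencil family, rate `1`). -/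
theorem summable_prod_vhSAt {L : ℕ} (hL : 1 ≤ L) {r : Fin (d + 1) → ℕ} (hr : r ∈ box (d + 1) L) (κ : Fin (d + 1)) (u : Site (d + 1)) (a b : Fib d) :
    Summable fun xz : Site (d + 1) × Site (d + 1) => vhSAt (toSite r) d L rfl κ u xz.1 xz.2 a b :=
  summable_prod_of_biLoc ((locStencil_vhSAt (d := d) hL hr zero_le_one) κ u) one_pos a b

/-- NOT IN PRINT; OUR BOOKKEEPING.  **THE fm SLOT CHARGE OF THE BORDER TABLE AS A COARSE SUM**: for a box root,
`Σ'_{(x,z)} vhSAt ρ d L κ u x z (inl α)(inr μ) = Σ'_y (((u + e_κ − ρ)_α − L·(y + e_μ)_α) · linKerAt ρ L μ y (κ,u))` — the multiplier leg sits at the fine images `z = L•y`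
only (`tsum_coarse_of_off`). -/
theorem tsum_prod_vhSAt_inl_inr_eq_coarse {L : ℕ} (hL : 1 ≤ L) {r : Fin (d + 1) → ℕ} (hr : r ∈ box (d + 1) L) (κ : Fin (d + 1)) (u : Site (d + 1))
    (α μ : Fin (d + 1)) :
    ∑' xz : Site (d + 1) × Site (d + 1), vhSAt (toSite r) d L rfl κ u xz.1 xz.2 (Sum.inl α) (Sum.inr μ)
      = ∑' y : Site (d + 1), ((((u + unitVec κ - toSite r) α : ℤ) : ℝ) - (L : ℝ) * (((y + unitVec μ) α : ℤ) : ℝ)) * linKerAt (toSite r) L μ y (κ, u) := by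
  rw [tsum_prod_eq_tsum_tsum_swap (F := fun x z => vhSAt (toSite r) d L rfl κ u x z (Sum.inl α) (Sum.inr μ))
    (summable_prod_vhSAt hL hr κ u (Sum.inl α) (Sum.inr μ))]
  have e : ∀ z : Site (d + 1), ∑' x, vhSAt (toSite r) d L rfl κ u x z (Sum.inl α) (Sum.inr μ)
      = ((((u + unitVec κ) α : ℤ) : ℝ) - (((z + toSite r + (L : ℤ) • unitVec μ) α : ℤ) : ℝ)) * linSymAt (toSite r) L u z (Sum.inl κ) (Sum.inr μ) :=
    fun z => tsum_vhSAt_inl_inr hL hr κ u z α μ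
  rw [tsum_congr e]
  have hoff : ∀ p : Site (d + 1), off L p ≠ 0 →
      ((((u + unitVec κ) α : ℤ) : ℝ) - (((p + toSite r + (L : ℤ) • unitVec μ) α : ℤ) : ℝ)) * linSymAt (toSite r) L u p (Sum.inl κ) (Sum.inr μ) = 0 := by
    intro p hp
    rw [linSymAt_inl_inr, if_neg hp, mul_zero]
  rw [tsum_coarse_of_off (Lc := L) hL hoff]
  refine tsum_congr fun y => ?_
  rw [linSymAt_inl_inr, if_pos (off_zsmul L y), blk_zsmul hL]
  congr 1
  simp only [Pi.add_apply, Pi.sub_apply, Pi.smul_apply, smul_eq_mul, unitVec_apply]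
  push_cast
  ring

/-- [folklore] **THE TWO-BLOCK REDUCTION**: for a box root the coarse family `y ↦ linKerAt ρ L μ y (κ,u)` is supported in `{blk u, blk u − e_μ}` (leaf-01's two-block support:
both endpoints of a bond seen by the rooted contours of `(μ,y)` have block label `y` or `y + e_μ`), so every weighted coarse sum over it is the two-term sum. -/
theorem tsum_linKerAt_twoBlock {L : ℕ} (hL : 1 ≤ L) {r : Fin (d + 1) → ℕ} (hr : r ∈ box (d + 1) L) (κ μ : Fin (d + 1)) (u : Site (d + 1))
    (c : Site (d + 1) → ℝ) :
    ∑' y : Site (d + 1), c y * linKerAt (toSite r) L μ y (κ, u)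
      = c (blk L u) * linKerAt (toSite r) L μ (blk L u) (κ, u) + c (blk L u - unitVec μ) * linKerAt (toSite r) L μ (blk L u - unitVec μ) (κ, u) := by
  classical
  have hne : blk L u ≠ blk L u - unitVec μ := by
    intro h
    have := congrFun h μ
    simp only [Pi.sub_apply, unitVec_apply, if_true] at this
    omega
  have hsupp : ∀ y, y ∉ ({blk L u, blk L u - unitVec μ} : Finset (Site (d + 1))) → c y * linKerAt (toSite r) L μ y (κ, u) = 0 := by
    intro y hy
    rw [Finset.mem_insert, Finset.mem_singleton, not_or] at hy
    rw [linKerAt_eq_zero_of_not_twoBlock hL hr, mul_zero]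
    rintro ⟨h1, -⟩
    rcases h1 with h1 | h1
    · exact hy.1 h1.symm
    · refine hy.2 ?_
      have h1' : blk L u = y + unitVec μ := h1
      rw [h1', add_sub_cancel_right]
  rw [tsum_eq_sum (s := ({blk L u, blk L u - unitVec μ} : Finset (Site (d + 1)))) (fun y hy => hsupp y hy), Finset.sum_pair hne]

/-- [folklore] The two-block form of road-P2's total `Σ'_y linKerAt ρ L μ y (κ,u) = 𝟙[κ = μ]·(L^d)⁻¹`: only `blk u` and `blk u − e_μ` contribute. -/
theorem linKerAt_blk_add_linKerAt_blk_sub {L : ℕ} [NeZero L] (hL : 1 ≤ L) {r : Fin (d + 1) → ℕ} (hr : r ∈ box (d + 1) L) (κ μ : Fin (d + 1)) (u : Site (d + 1)) :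
    linKerAt (toSite r) L μ (blk L u) (κ, u) + linKerAt (toSite r) L μ (blk L u - unitVec μ) (κ, u) = if κ = μ then ((L : ℝ) ^ d)⁻¹ else 0 := by
  have h := tsum_linKerAt_twoBlock hL hr κ μ u (fun _ => (1 : ℝ))
  simp only [one_mul] at h
  rw [← h, tsum_linKerAt' hL hr μ (κ, u)]

/-- NOT IN PRINT; OUR BOOKKEEPING.  **THE fm SLOT CHARGE OF THE BORDER TABLE, CLOSED FORM**: for a box root `ρ = toSite r`, `L ≥ 1`, slot `(κ,u)`, channel `(inl α, inr μ)`,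
`Σ'_{(x,z)} vhSAt ρ d L κ u x z (inl α)(inr μ) = 𝟙[κ = μ]·(L^d)⁻¹·(u + e_κ − ρ − L•blk u)_α − L·𝟙[α = μ]·linKerAt ρ L μ (blk u) (κ,u)` — an explicit function of the slot's
IN-BLOCK OFFSET `u − L•blk u` (first term) and of the own-block count through the slot (second term): NOT slot-constant. -/
theorem tsum_prod_vhSAt_inl_inr_eq {L : ℕ} [NeZero L] (hL : 1 ≤ L) {r : Fin (d + 1) → ℕ} (hr : r ∈ box (d + 1) L) (κ : Fin (d + 1)) (u : Site (d + 1))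
    (α μ : Fin (d + 1)) :
    ∑' xz : Site (d + 1) × Site (d + 1), vhSAt (toSite r) d L rfl κ u xz.1 xz.2 (Sum.inl α) (Sum.inr μ)
      = (if κ = μ then ((L : ℝ) ^ d)⁻¹ else 0) * (((u + unitVec κ - toSite r - (L : ℤ) • blk L u) α : ℤ) : ℝ)
        - (L : ℝ) * (if α = μ then (1 : ℝ) else 0) * linKerAt (toSite r) L μ (blk L u) (κ, u) := by
  rw [tsum_prod_vhSAt_inl_inr_eq_coarse hL hr, tsum_linKerAt_twoBlock hL hr κ μ u, ← linKerAt_blk_add_linKerAt_blk_sub hL hr κ μ u]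
  simp only [Pi.add_apply, Pi.sub_apply, Pi.smul_apply, smul_eq_mul, unitVec_apply]
  push_cast
  ring

/-! ## §3 The located negative: the fm slot charge of the level-0 pure S table moves with the slot inside a block -/

/-- NOT IN PRINT; OUR BOOKKEEPING.  **THE `(inl α, inr μ)` SLOT CHARGE OF THE LEVEL-0 PURE S TABLE** = `cVH ·` the border table's (§2):
`Σ'_{(x,z)} SpureRecAt d Lc ρ cE cVH cΛ 0 κ u x z (inl α)(inr μ) = cVH·(𝟙[κ = μ]·(Lc^d)⁻¹·(u + e_κ − ρ − Lc•blk u)_α − Lc·𝟙[α = μ]·linKerAt ρ Lc μ (blk u) (κ,u))`. -/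
theorem tsum_prod_spureRecAt_zero_inl_inr_eq {Lc : ℕ} [NeZero Lc] (hLc : 1 ≤ Lc) {r : Fin (d + 1) → ℕ} (hr : r ∈ box (d + 1) Lc) (cE cVH cΛ : ℝ)
    (κ : Fin (d + 1)) (u : Site (d + 1)) (α μ : Fin (d + 1)) :
    ∑' xz : Site (d + 1) × Site (d + 1), SpureRecAt d Lc (toSite r) cE cVH cΛ 0 κ u xz.1 xz.2 (Sum.inl α) (Sum.inr μ)
      = cVH * ((if κ = μ then ((Lc : ℝ) ^ d)⁻¹ else 0) * (((u + unitVec κ - toSite r - (Lc : ℤ) • blk Lc u) α : ℤ) : ℝ)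
          - (Lc : ℝ) * (if α = μ then (1 : ℝ) else 0) * linKerAt (toSite r) Lc μ (blk Lc u) (κ, u)) := by
  simp only [spureRecAt_zero_inl_inr]
  rw [tsum_mul_left, tsum_prod_vhSAt_inl_inr_eq hLc hr]

/-- NOT IN PRINT; OUR BOOKKEEPING.  **`hζS` FAILS ON THE fm BLOCKS — THE SLOT STEP**: for `κ = μ`, a transverse direction `α ≠ μ`, and ANY slot `u`, the `(inl α, inr μ)` slot
charge of the level-0 pure S table changes from the slot `(μ, u)` to the slot `(μ, u + e_α)` by `cVH·(Lc^d)⁻¹·(1 − Lc·((blk (u+e_α))_α − (blk u)_α))` — i.e. by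
`cVH·(Lc^d)⁻¹` when the two slots lie in the same block, and by `cVH·(Lc^d)⁻¹·(1 − Lc)` across a face: NOT slot-constant unless `cVH = 0` (road-P2's E26g spread
`|cVH|·(Lc−1)·Lc^{−d}`).  The transverse count term is absent (`α ≠ μ`). -/
theorem tsum_prod_spureRecAt_zero_inl_inr_step {Lc : ℕ} [NeZero Lc] (hLc : 1 ≤ Lc) {r : Fin (d + 1) → ℕ} (hr : r ∈ box (d + 1) Lc) (cE cVH cΛ : ℝ)
    {μ α : Fin (d + 1)} (hα : α ≠ μ) (u : Site (d + 1)) :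
    (∑' xz : Site (d + 1) × Site (d + 1), SpureRecAt d Lc (toSite r) cE cVH cΛ 0 μ (u + unitVec α) xz.1 xz.2 (Sum.inl α) (Sum.inr μ))
      - ∑' xz : Site (d + 1) × Site (d + 1), SpureRecAt d Lc (toSite r) cE cVH cΛ 0 μ u xz.1 xz.2 (Sum.inl α) (Sum.inr μ)
      = cVH * ((Lc : ℝ) ^ d)⁻¹ * (1 - (Lc : ℝ) * ((((blk Lc (u + unitVec α)) α : ℤ) : ℝ) - (((blk Lc u) α : ℤ) : ℝ))) := by
  rw [tsum_prod_spureRecAt_zero_inl_inr_eq hLc hr, tsum_prod_spureRecAt_zero_inl_inr_eq hLc hr]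
  simp only [if_true, if_neg hα, mul_zero, zero_mul, sub_zero]
  simp only [Pi.add_apply, Pi.sub_apply, Pi.smul_apply, smul_eq_mul, unitVec_apply, if_true, if_neg hα]
  push_cast
  ring

/-- NOT IN PRINT; OUR BOOKKEEPING.  **INSIDE A BLOCK THE STEP IS `cVH·(Lc^d)⁻¹`**: if `u` and `u + e_α` have the same block label (`α ≠ μ`), the two slot charges differ by
exactly `cVH·(Lc^d)⁻¹`; hence for `cVH ≠ 0` NO constant `ζS μ` satisfies road-P2's `hζS` in the channel `(inl α, inr μ)`. -/
theorem tsum_prod_spureRecAt_zero_inl_inr_step_of_blk_eq {Lc : ℕ} [NeZero Lc] (hLc : 1 ≤ Lc) {r : Fin (d + 1) → ℕ} (hr : r ∈ box (d + 1) Lc)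
    (cE cVH cΛ : ℝ) {μ α : Fin (d + 1)} (hα : α ≠ μ) {u : Site (d + 1)} (hu : blk Lc (u + unitVec α) = blk Lc u) :
    (∑' xz : Site (d + 1) × Site (d + 1), SpureRecAt d Lc (toSite r) cE cVH cΛ 0 μ (u + unitVec α) xz.1 xz.2 (Sum.inl α) (Sum.inr μ))
      - ∑' xz : Site (d + 1) × Site (d + 1), SpureRecAt d Lc (toSite r) cE cVH cΛ 0 μ u xz.1 xz.2 (Sum.inl α) (Sum.inr μ)
      = cVH * ((Lc : ℝ) ^ d)⁻¹ := by
  rw [tsum_prod_spureRecAt_zero_inl_inr_step hLc hr cE cVH cΛ hα u, hu, sub_self, mul_zero, sub_zero, mul_one]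

/-- NOT IN PRINT; OUR BOOKKEEPING.  **`hζS` IS UNSATISFIABLE ON THE fm BLOCKS** (`cVH ≠ 0`, some transverse direction `α ≠ μ`, `Lc ≥ 2` so that a block has two slots
`u`, `u + e_α`): there is NO `ζ : ℝ` with `Σ'_{(x,z)} SpureRecAt … 0 μ u x z (inl α)(inr μ) = ζ` for all `u`. Witness: `u = Lc • 0 = 0` and `u + e_α` (same block since `Lc ≥ 2`). -/
theorem not_slotConst_spureRecAt_zero_inl_inr {Lc : ℕ} [NeZero Lc] (hLc : 2 ≤ Lc) {r : Fin (d + 1) → ℕ} (hr : r ∈ box (d + 1) Lc)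
    (cE : ℝ) {cVH : ℝ} (hcVH : cVH ≠ 0) (cΛ : ℝ) {μ α : Fin (d + 1)} (hα : α ≠ μ) :
    ¬ ∃ ζ : ℝ, ∀ u : Site (d + 1),
        ∑' xz : Site (d + 1) × Site (d + 1), SpureRecAt d Lc (toSite r) cE cVH cΛ 0 μ u xz.1 xz.2 (Sum.inl α) (Sum.inr μ) = ζ := by
  rintro ⟨ζ, hζ⟩
  have hLc1 : 1 ≤ Lc := by omega
  have hblk : blk Lc ((0 : Site (d + 1)) + unitVec α) = blk Lc (0 : Site (d + 1)) := by
    funext i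
    simp only [AveragingContours.blk, Pi.add_apply, Pi.zero_apply, unitVec_apply, zero_add]
    have hL2 : (2 : ℤ) ≤ (Lc : ℤ) := by exact_mod_cast hLc
    split_ifs
    · rw [Int.ediv_eq_zero_of_lt (by norm_num) (by omega), Int.zero_ediv]
    · simp
  have h := tsum_prod_spureRecAt_zero_inl_inr_step_of_blk_eq hLc1 hr cE cVH cΛ hα hblk
  rw [hζ, hζ, sub_self] at h
  have hL0 : ((Lc : ℝ) ^ d)⁻¹ ≠ 0 := inv_ne_zero (pow_ne_zero _ (by exact_mod_cast (NeZero.ne Lc)))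
  exact (mul_ne_zero hcVH hL0) h.symm

end Summit.QuantumFields.BalabanUV.Beta.GAN24.SpureSlotChargeLevelZero

end
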